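import Summits.CriticalPhenomena.Ising3DConformalLimit.Theses.PerfectScreening
import Summits.CriticalPhenomena.Ising3DConformalLimit.Theorems.CoulombImpliesNontrivial.Negative.Antecedent

/-!
# Line `CoulombBranchIsFree` — lead skeleton v1 for crux stmt-CriticalPhenomena-13885 `CoulombImpliesNontrivial`
(lead a2, 2026-08-17; from crux-ideate round-2 ideator 5's `Cruxes/CoulombImpliesNontrivial/CoulombBranchIsFree.lean`, R5)

Composition (pure logic + transport of the limit hypotheses along `EqOn` on `NonCoincident`):

  `CoulombImpliesNontrivial_of : stub_moebiusForcesScreening → stub_coulombNonMoebiusInteracting → CoulombImpliesNontrivial`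

* `stub_moebiusForcesScreening` (r3', OPEN, lead): a Möbius-covariant non-degenerate pointwise limit of `criticalCorr 3`
  forces `NonSaturation` (weak `η(3) > 0`, item stmt-1342) — equivalently `¬GFP⁺`, "the massless free field with `Z > 0` is
  not the conformal scaling limit of n.n. Ising₃" (landed `moebiusForcesScreening_iff_noFreeCoulombLimit`). Implied by the crux
  (landed `stub_moebiusForcesScreeningOfCrux`); suffices for the ROUTE (landed `stub_closesOfMoebiusForcesScreening` = the
  deciding theorem with r3 replaced by r3'). Lattice shadow false (landed `latticeShadow_moebiusForcesScreening_false`).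
* `stub_coulombNonMoebiusInteracting` (faithful clause₂, OPEN): under the Coulomb antecedent every non-degenerate pointwise
  limit that agrees on `NonCoincident` with NO Möbius-covariant family is interacting. (The ideator's naive form
  `(∀ Δ, ¬ IsMoebiusCovariant Δ S) → HasNontrivialU4 S` is equivalent to the crux itself by coincident-configuration junk:
  landed `naiveNonMoebiusClause_iff_crux`.) Lattice shadow false by an ANISOTROPIC free family (landed
  `latticeShadow_faithfulNonMoebiusClause_false`): it contains "emergent conformality or interaction of every η = 0 limit".
Landed companions: `Theorems/PerfectScreeningCoulombImpliesNontrivialCoulombBranchIsFree{,Shadows}.lean`.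
-/

noncomputable section

namespace Summit.CriticalPhenomena.Ising3DConformalLimit.Cruxes.CoulombImpliesNontrivial.Lines.CoulombBranchIsFree

open Literature.Probability.LatticeModels Filter Set
open Summit.CriticalPhenomena.Ising3DConformalLimit.Theses.PerfectScreening
open Summit.CriticalPhenomena.Ising3DConformalLimit.CoulombImpliesNontrivialNegative

/-- STUB 1 (r3' = `MoebiusForcesScreening` = `¬GFP⁺`; OPEN, crux-sized: the 3D non-triviality core in its sharpest dress). -/
theorem stub_moebiusForcesScreening : ∀ (ρ : ℝ → ℝ) (Δ : ℝ) (S : CorrFamily 3), (∀ δ ∈ Set.Ioc (0:ℝ) 1, 0 < ρ δ) → HasPointwiseScalingLimit (criticalCorr 3) ρ S → IsNondegenerateTwoPoint S → IsMoebiusCovariant Δ S → Summit.CriticalPhenomena.Ising3DConformalLimit.Theses.PerfectScreening.NonSaturation := by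
  sorry

/-- STUB 2 (faithful non-Möbius clause; OPEN, crux-sized: emergent conformality OR interaction of every η = 0 limit). -/
theorem stub_coulombNonMoebiusInteracting : (∃ c : ℝ, 0 < c ∧ ∀ x : Site 3, x ≠ 0 → c / ‖x‖ ≤ criticalTwoPoint 3 x) → ∀ (ρ : ℝ → ℝ) (S : CorrFamily 3), (∀ δ ∈ Set.Ioc (0:ℝ) 1, 0 < ρ δ) → HasPointwiseScalingLimit (criticalCorr 3) ρ S → IsNondegenerateTwoPoint S → (∀ (Δ : ℝ) (S' : CorrFamily 3), IsMoebiusCovariant Δ S' → ¬ ∀ n, (NonCoincident 3 n).EqOn (S n) (S' n)) → HasNontrivialU4 S := by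
  sorry

/-- A pointwise scaling limit only sees the limit family ON `NonCoincident`. [folklore] -/
theorem hasPointwiseScalingLimit_of_eqOn {G : LatticeCorrFamily 3} {ρ : ℝ → ℝ} {S S' : CorrFamily 3}
    (hlim : HasPointwiseScalingLimit G ρ S) (h : ∀ n, (NonCoincident 3 n).EqOn (S n) (S' n)) :
    HasPointwiseScalingLimit G ρ S' :=
  fun n => (hlim n).congr_right (h n)

/-- Non-degeneracy only sees `S₂` on `NonCoincident`. [folklore] -/
theorem isNondegenerateTwoPoint_of_eqOn {S S' : CorrFamily 3} (hnd : IsNondegenerateTwoPoint S)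
    (h : (NonCoincident 3 2).EqOn (S 2) (S' 2)) : IsNondegenerateTwoPoint S' :=
  fun x hx => h hx ▸ hnd x hx

/-- **GLUE.** The crux from the two stubs: if the limit `S` is NonCoincident-equivalent to a Möbius family `S'`, then
`S'` is itself a non-degenerate Möbius pointwise limit and STUB 1 yields `NonSaturation`, contradicting the antecedent
(`coulomb_iff_not_nonSaturation`); otherwise STUB 2 applies. [folklore] -/
theorem CoulombImpliesNontrivial_of
    (h₁ : ∀ (ρ : ℝ → ℝ) (Δ : ℝ) (S : CorrFamily 3), (∀ δ ∈ Set.Ioc (0:ℝ) 1, 0 < ρ δ) →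
      HasPointwiseScalingLimit (criticalCorr 3) ρ S → IsNondegenerateTwoPoint S → IsMoebiusCovariant Δ S →
      Summit.CriticalPhenomena.Ising3DConformalLimit.Theses.PerfectScreening.NonSaturation)
    (h₂ : (∃ c : ℝ, 0 < c ∧ ∀ x : Site 3, x ≠ 0 → c / ‖x‖ ≤ criticalTwoPoint 3 x) →
      ∀ (ρ : ℝ → ℝ) (S : CorrFamily 3), (∀ δ ∈ Set.Ioc (0:ℝ) 1, 0 < ρ δ) →
        HasPointwiseScalingLimit (criticalCorr 3) ρ S → IsNondegenerateTwoPoint S →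
        (∀ (Δ : ℝ) (S' : CorrFamily 3), IsMoebiusCovariant Δ S' → ¬ ∀ n, (NonCoincident 3 n).EqOn (S n) (S' n)) →
        HasNontrivialU4 S) :
    Summit.CriticalPhenomena.Ising3DConformalLimit.Theses.PerfectScreening.CoulombImpliesNontrivial := by
  intro hC ρ S hρ hlim hnd
  by_cases hM : ∃ (Δ : ℝ) (S' : CorrFamily 3), IsMoebiusCovariant Δ S' ∧ ∀ n, (NonCoincident 3 n).EqOn (S n) (S' n)
  · obtain ⟨Δ, S', hM', heq⟩ := hM
    exact absurd (h₁ ρ Δ S' hρ (hasPointwiseScalingLimit_of_eqOn hlim heq)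
      (isNondegenerateTwoPoint_of_eqOn hnd (heq 2)) hM') (coulomb_iff_not_nonSaturation.1 hC)
  · exact h₂ hC ρ S hρ hlim hnd (fun Δ S' hMS' heq => hM ⟨Δ, S', hMS', heq⟩)

/-- The crux, modulo the two stubs. -/
theorem CoulombImpliesNontrivial_proof :
    Summit.CriticalPhenomena.Ising3DConformalLimit.Theses.PerfectScreening.CoulombImpliesNontrivial :=
  CoulombImpliesNontrivial_of stub_moebiusForcesScreening stub_coulombNonMoebiusInteracting

end Summit.CriticalPhenomena.Ising3DConformalLimit.Cruxes.CoulombImpliesNontrivial.Lines.CoulombBranchIsFree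

end
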